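import Mathlib
import HarnessLib
import HarnessLib.Audit
import Summits.AtomisticToContinuum.Statement

/-!
Route: ZeroHorizon

CLOSED (retired) 2026-08-15T13:47:37Z by operator:999:1257524 — reason: not-a-thesis: assembly does not conclude the sub-problem Statement — note: D-0027 §2.1 audit (human 2026-08-15: routes that do not decide the summit are removed): the assembly concludes `Literature.MathematicalPhysics.KineticTheory.HydrodynamicLimit`, not the sub-problem statement; a NEW conforming route may be opened from the same idea (generated `closes : … → _root_.Hydr. The file is kept as the record of this route; refuted decls are indexed as negative knowledge (`ledger negatives`).

# Route ZeroHorizon — Zero horizon — annealed statistical closure gives Euler up to the first shock;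
past the first slip surface the same bookkeeping predicts O(1) realisation spread at fixed times

X = X₊ ∧ X₋ ("it suffices to show"), realising card zero-horizon-statistical-solutions (spine; its
Z1 = X₋, its Z2/Z3 pre-shock assembly (c) = X₊ in the sharpened ANNEALED form found while planning).
X₊ (ANNEALED STATISTICAL CLOSURE, positive, pre-shock, → the conjunct): (i) MeanFluxClosure — the
LAW-AVERAGED, time-integrated momentum and energy conservation laws of the empirical fields close on
the hard-sphere Euler fluxes m⊗m/ρ + p(ρ,θ)𝟙 and (E+p)m/ρ evaluated on kernel-mollified fields, in
the double limit (kernel radius ℓ → 0 after N → ∞), for all times (mass is exact: support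
MassContinuity); (ii) MeanSecondLaw — the law-averaged coarse-grained mathematical entropy ∫
−ρs(U^k_N(t)) dx never exceeds its initial value (Liouville invariance of the global Gibbs state +
Gibbsian large deviations; no kinetic equation, no H-theorem); (iii) AnnealedWeakStrong —
(i)+(ii)+Dirac initial data force convergence in probability to the classical solution while it
exists and stays dilute: the Fjordholm–Lye–Mishra–Weber weak–strong uniqueness for DISSIPATIVE
STATISTICAL SOLUTIONS with a Dirac initial law uses only functionals LINEAR in the law (first
correlation marginal + mean entropy inequality), so at the particle level plain expectations suffice
— no pathwise (quenched) identification of limit points, no random Young measures, no propagation of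
chaos. With the packing guard discharged by the shared item DiluteSelfConsistency this is
HydrodynamicLimit.
X₋ (ZERO HORIZON, negative, typed headline): ZeroHorizonSpread — for some smooth local-Gibbs
profile, some fixed macroscopic time t, test function χ and δ > 0, at arbitrarily small reduced
density, the law of the empirical momentum field ⟨m_N(t), χ⟩ concentrates around NO deterministic
centring (not even an N-dependent one): realisation-to-realisation differences are O(1). Mechanism:
a slip surface born at T_s ≥ T* spreads only viscously, w ≍ (Kn t′)^1/2 with Kn ≍ σ⁻²N^(−1/3), so
the Kelvin–Helmholtz Ehrenfest time collapses from (2γ)⁻¹ log N to t′_E ≍ Kn (log N)²/(64ΔU²) → 0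
and thermal N^(−1/2) seeds reach O(1) at fixed t > T_s. X₋ implies nothing about the conjunct; with
SpreadExcludesLimit / SpreadBoundsClassicalTime it is the typed statement that the deterministic
description ends (and, under the conjunct, that classical solutions from those data die) by time t —
the frontier of DETERMINISTIC hydrodynamics is the first slip surface, and beyond it only limits IN
LAW (statistical solutions) can be claimed.
Lean: `MeanFluxClosure ∧ MeanSecondLaw ∧ AnnealedWeakStrong ∧ ZeroHorizonSpread`

## Assembly
Pure quantifier bookkeeping, proved sorry-free as `assembly_holds` in the planner's Sketch.lean
(lean check rc 0, axioms propext/Classical.choice/Quot.sound): AnnealedWeakStrong applied to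
MeanFluxClosure and MeanSecondLaw yields η₀ and the packing-guarded conjunct; given profiles take σ₁
from it and σ₃ from DiluteSelfConsistency at η := η₀, σ₀ := min σ₁ σ₃; for σ < σ₀, a classical
solution on [0,T), flows Φ and the t = 0 hypothesis, DiluteSelfConsistency gives the guard and the
guarded conjunct gives TendstoHydroFieldsAt at every t < T — HydrodynamicLimit unfolded
(hydrodynamicLimit_iff). ZeroHorizonSpread is not an antecedent: it is the route's negative
deliverable, tied to the conjunct by the two Spread supports; MassContinuity is a lemma for the
prover of AnnealedWeakStrong.

Rationale: WHY THIS LINE. Statistical solutions (FjordholmLanthalerMishra2017; FjordholmEtAl2020, Def. 27 and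
Lemma 28/Thm 30) are time-parametrised laws on fields whose weak–strong uniqueness with a Dirac
initial law is proved by Dafermos' relative entropy computed IN EXPECTATION — every step
(first-moment equation tested with η′(Ū), global entropy inequality, flux remainder) is linear in
the law; transplanted to the fixed-density hard-sphere gas (relative-energy technique of
Dafermos1979 / BrezinaFeireisl2018 for the complete Euler system in place of FLMW's bounded-Hessian
hypotheses) this says the microscopic input for the conjunct is ANNEALED: mean flux closure and a
mean second law, the latter obtainable from Liouville invariance plus Georgii1994-type large
deviations of the invariant Gibbs state (imported areas: statistical/measure-valued solutions of
hyperbolic systems and their numerics; large deviations for Gibbs point processes). The same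
statistical bookkeeping, run past the first singularity with the vortex-sheet stability theory of
Miles1958 / FejerMiles1963 / CoulombelSecchi2004 and the mixing-layer phenomenology of
BrownRoshko1974, gives the card's zero-horizon law and the typed negative statement
ZeroHorizonSpread: thermal noise is amplified to macroscopic randomness in time Kn(log N)² → 0 after
a slip surface forms (ThalabardBecMailybaev2020, BandakEtAl2024 and EyinkPeng2025 reach the same
conclusion from fluctuating hydrodynamics; KadauEtAl2004 see thermally seeded instabilities in MD) —
so beyond the first slip surface the hydrodynamic limit can only hold in law, with FLM statistical
solutions as the limit object. What prior routes do not do: RelEntropyErgodic / ChaoticMixing /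
VanishingNoise / DenseKineticExpansion / OneParticleInfluence prove STRONG (microscopic) local
equilibrium; DissipativeWeakStrong asks for QUENCHED mv closure (every limit point of the joint law
a.s. a dissipative mv solution, informal); the parallel route EntropyBookkeeping (opened the same
hour) types the same modulated-entropy architecture in QUENCHED form — MomentumFluxLocality /
EnergyFluxLocality (defects → 0 in probability, pre-shock frame), MacroSecondLaw (w.h.p.), a
pathwise Gronwall on a NoConcentration event — and KnudsenRate types the log N EhrenfestHorizon for
smooth Kolmogorov shear at times C log N. This route's deltas: (1) every X₊ item is ANNEALED (plain
expectations: weaker conclusions than the quenched ones under uniform integrability, so easier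
cruxes), and AnnealedWeakStrong shows they still suffice because FLMW's Lemma 28 runs in expectation
— no NoConcentration event, no good set, the price being state-space control in mean; (2)
MeanFluxClosure is stated for ALL times, as the one microscopic input the post-shock
statistical-solution programme (limits in law) also needs; (3) X₋ is the fixed-time (zero-horizon)
negative for dynamically created slip surfaces, against arbitrary N-dependent centrings, where
EhrenfestHorizon needs t_N ≍ log N for smooth shear; the negatives index is empty at filing.

RANKED CRUXES. #2 ZeroHorizonSpread (crux) — (card Z1, zero-horizon variance explosion, in centring
form) there are continuous positive profiles (a₀, θ₀) and u₀, a time t > 0, a continuous χ and δ > 0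
such that for every σ₀ > 0 some reduced density 0 < σ < σ₀ has: for every family of hard-sphere
flows and EVERY deterministic centring c : ℕ → V3, frequently in N the local Gibbs law gives
probability ≥ δ to {‖⟨empirical momentum field at time t, χ⟩ − c_N‖ > δ}. Equivalently two
independent realisations differ by O(1) with non-vanishing probability; intended witness: smoothed
four-quadrant / oblique-shock data on 𝕋³ (functions of two coordinates) whose hs-Euler evolution
produces a SUBSONIC slip surface at T_s, observed at any fixed t > T_s. [difficulty: open-problem]
(why it might fail: hs-Euler slip surfaces from generic smooth data might be born with macroscopic
width (horizon ≍ log N), be supersonic/stabilised by compressibility or density ratio (Miles,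
Coulombel–Secchi), or saturate at mesoscopic amplitude so the spread at fixed χ is o(1).)
[ThalabardBecMailybaev2020, BandakEtAl2024, EyinkPeng2025, Miles1958, FejerMiles1963,
CoulombelSecchi2004, CoulombelSecchi2008, BrownRoshko1974, ChangChenYang1995, KadauEtAl2004]
#3 MeanFluxClosure (crux) — (card Z2 in annealed form: the universal closure crux, weakest version)
for all continuous positive profiles there is σ₀ > 0 such that for 0 < σ < σ₀, every flow family,
all times 0 ≤ t₁ ≤ t₂ and ε > 0, for every smooth scalar ψ (energy) and smooth vector field φ
(momentum) there is a kernel radius ℓ > 0 such that for every continuous probability kernel k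
supported in the ℓ-ball, eventually in N, the PATHWISE defects ⟨E_N(t₂) − E_N(t₁), ψ⟩ − ∫_{t₁}^{t₂}∫
((E^k + p)/ρ^k) m^k·∇ψ dx ds and ⟨m_N(t₂) − m_N(t₁), φ⟩ − ∫_{t₁}^{t₂}∫ [(m^k⊗m^k/ρ^k):∇φ + p div φ]
dx ds — (ρ^k, m^k, E^k) the k-mollified empirical fields of the time-s configuration, θ^k =
⅔(E^k/ρ^k − |m^k|²/2(ρ^k)²), p = hsPressure σ ρ^k θ^k — are integrable under the local Gibbs law and
have |expectation| ≤ ε. Only the MEAN over the initial law is asked (annealed), not smallness in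
probability of the defect (quenched): this is what a statistical-solution limit needs and strictly
less than mv/Young-measure identification; the continuity equation is exact and filed separately
(MassContinuity). [difficulty: open-problem] (why it might fail: Local equilibrium of contact
statistics must hold IN MEAN along deterministic dynamics at fixed density: persistent
ring/recollision correlations (O(1) per mean free time) could shift E[flux] off ρu⊗u + ρθZ𝟙 at
leading order; post-shock the ℓ → 0 limit must absorb subscale Reynolds stresses.) [Spohn1991,
OllaVaradhanYau1993, FjordholmLanthalerMishra2017, FjordholmEtAl2020, KipnisLandim1999]
#4 MeanSecondLaw (crux) — (the free second law, annealed; cf. card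
invariant-gibbs-entropy-bookkeeping (ii)) for all continuous positive profiles there is σ₀ > 0 such
that for 0 < σ < σ₀, every flow family and every triple (ρ₁, u₁, θ₁) that is the time-0 limit in
probability of the empirical fields: for every t ≥ 0 and ε > 0 there is ℓ > 0 such that for every
continuous probability kernel k supported in the ℓ-ball, eventually in N, the coarse-grained
mathematical entropy S(z) = ∫ η_σ(ρ^k, m^k, E^k)(x) dx of the time-t configuration, η_σ(U) = −ρ(3/2
log θ(U) − log ρ − hsExcessFreeEnergy(ρσ³)), is integrable under the local Gibbs law and E[S] ≤ ∫
η_σ(ρ₁, ρ₁u₁, E(ρ₁,u₁,θ₁)) dx + ε. Proposed proof: H(P_t | G) = H(P_0 | G) for the invariant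
canonical Gibbs law G (Liouville, HardSphereFlow.measurePreserving), Donsker–Varadhan + Varadhan's
lemma against the Georgii large-deviation principle of the k-mollified profile under G at small
activity, Jensen for k-averages (η_σ convex), and exact conservation of ∫U^k dx; this is
FjordholmEtAl2020 Def. 27(ii) for the limit law. [difficulty: L] (why it might fail: Needs the LDP /
equivalence of ensembles for the mollified (ρ,m,E)-profile under the canonical hard-sphere state on
all states the coarse-grained field visits; Georgii1994 covers small activity, but dense or cold
pockets enter through hsExcessFreeEnergy where no expansion converges.) [Georgii1994,
GeorgiiZessin1993, Ruelle1969, LebowitzPenrose1964, FjordholmEtAl2020, Spohn1991]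
#5 AnnealedWeakStrong (crux) — (card Z3, statistical weak–strong uniqueness for the hs equation of
state collapsed to first moments; PDE + measure theory) MeanFluxClosure → MeanSecondLaw →
HydroLimitInBand, where the conclusion is VERBATIM the packing-guarded conjunct of route
ImplosionLoophole (stmt-AtomisticToContinuum-3093): ∃ η₀ > 0 such that for all continuous positive
profiles ∃ σ₀ ∀ σ < σ₀, every classical hs-Euler solution on [0,T) with ρσ³ < η₀ throughout and
every flow family whose local Gibbs fields converge at t = 0 has fields converging in probability at
every t < T. Intended proof = the LOCAL theorem (per σ, per solution): FjordholmEtAl2020 Lemma 28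
with M = 1 — evolve E∫η_σ(U^k_N(t) | U^E(t)) dx by the mean conservation laws tested with η_σ′(U^E)
(time-stepped; mass from MassContinuity), isentropy of the classical solution and the mean entropy
bound; flux remainder |F(U) − F(Ū) − DF(Ū)(U−Ū)| ≲ η_σ(U|Ū) by the relative-energy technique for the
complete Euler system (BrezinaFeireisl2018) with strict convexity of η_σ at packing < η₀
(HsEntropyConvex of route DissipativeWeakStrong); E∫η_σ(·|·) → 0 gives ∫|U^k − U^E| → 0 in
probability, then ℓ → 0 by continuity of χ. [deps: MeanFluxClosure, MeanSecondLaw] [difficulty: L]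
(why it might fail: Relative flux ≲ relative entropy and coercivity of η_σ(U|Ū) are needed on ALL
states the mollified particle fields take (near-vacuum, cold spots, packing near close-packing where
hsExcessFreeEnergy is limsup-defined), not only near the strong solution; FLMW assume bounded
Hessians, Euler has none.) [FjordholmEtAl2020, Dafermos1979, BrezinaFeireisl2018,
GwiazdaSwierczewskagwiazdaWiedemann2015, BrenierDeLellisSzekelyhidi2011,
LanthalerMishraParespulido2021]
#9 DiluteSelfConsistency (support) — (shared verbatim with route ImplosionLoophole,
stmt-AtomisticToContinuum-3091; discharges the packing guard of AnnealedWeakStrong) for every η > 0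
and all continuous positive profiles there is σ₀ such that for σ < σ₀ every classical hs-Euler
solution whose t = 0 fields are the LLN limit of the local Gibbs laws keeps ρ_t(x)σ³ < η on [0,T).
[difficulty: open-problem] (why it might fail: owned by route ImplosionLoophole: its negation
DenseExcursion (implosion tracking) is a live crux there.) [Sideris1985, LukSpeck2024,
CaolaboraEtAl2025, BuckmasterCaolaboraGomezserrano2025]
#9 MassContinuity (support) — (exact continuity equation in the same annealed format; provable from
the HardSphereFlow trajectory axioms alone) for every σ > 0, continuous positive profiles, flow
family, N, t₁ ≤ t₂ and smooth ψ, the pathwise defect ⟨ρ_N(t₂),ψ⟩ − ⟨ρ_N(t₁),ψ⟩ − ∫_{t₁}^{t₂} Σᵢ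
⟨m_N(s), ∂ᵢψ⟩ᵢ ds is integrable under the local Gibbs law with integral 0: it vanishes identically
on the good set (free flight + continuity of positions, FTC for piecewise-C¹ s ↦ ψ(x_k(s))) and the
law is absolutely continuous w.r.t. Liouville (particleLaw = withDensity). Feeds the mass equation
to the prover of AnnealedWeakStrong. [difficulty: M] [GST2013, Alexander1975, Spohn1991]
#9 SpreadExcludesLimit (support) — (glue, provable now; proof in the planner's Sketch.lean) for any
laws P_N, flows, time t, continuous χ and δ > 0: if for every centring c : ℕ → V3 frequently
P_N{‖⟨m_N(t),χ⟩ − c_N‖ > δ} ≥ δ, then NO fields (ρ,u,θ) whatsoever satisfy TendstoHydroFieldsAt P Φ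
ρ u θ t. Makes ZeroHorizonSpread a typed refutation of every deterministic description at time t
(classical, weak, mv-barycentre …). [difficulty: provable-now] [Spohn1991]
#9 SpreadBoundsClassicalTime (support) — (glue, provable now; proof in Sketch.lean) if
HydrodynamicLimitFor σ holds and the spread of ZeroHorizonSpread occurs at (σ, profiles, t ≥ 0, χ,
δ) for a flow family Φ, then every classical hs-Euler solution on [0,T) whose time-0 fields are the
local-Gibbs LLN limit along Φ has T ≤ t: under the conjunct, randomisation by time t is a
particle-level certificate of classical breakdown before t (contrapositive: global classical
solutions ⇒ no spread ever). [difficulty: provable-now] [Spohn1991, Sideris1985]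

TWO-LAYER PLAN. Foreseen glued splits (none filed now, k ≤ 3, depth 1): MeanFluxClosure ⇐
MomentumVirialClosure (trace part: mean kinetic + collisional virial = 3p + ρ|u|², the
equation-of-state identity in mean) → DeviatoricClosure (mean pressure tensor isotropic at scale ℓ)
→ EnergyFluxClosure; MeanSecondLaw ⇐ GibbsProfileLDP (Georgii-type LDP for the k-mollified (ρ,m,E)
profile under the invariant canonical hard-sphere state, small activity) → LiouvilleEntropyTransfer
(H(P_t|G) = H(P_0|G) + Donsker–Varadhan + Jensen); AnnealedWeakStrong ⇐ LocalAnnealedWeakStrong (the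
per-(σ, solution) theorem with closure and second law as local hypotheses; it was the planner's
first typed form, 6.5k chars, over the gate's 4000-char signature cap, hence the global form at
open) → MeanRelEntropyGronwall (d/dt E∫η_σ(U^k|U^E) ≤ C E∫η_σ(U^k|U^E) + o(1)) →
RelEntropyControlsFields (E∫η_σ(·|·) → 0 ⇒ TendstoHydroFieldsAt); ZeroHorizonSpread ⇐ OnsetLaw
(linear, PDE) → NonlinearSaturationSpread.

KILL CRITERIA. Refutation of MeanFluxClosure (a smooth pre-shock datum for which the law-averaged
momentum or energy flux stays off the hs-Euler flux at leading order) closes the route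
`refuted:MeanFluxClosure` and, since annealed closure is the weakest closure any route uses, would
all but refute the conjunct — file ¬HydrodynamicLimitFor then. Refutation of MeanSecondLaw as stated
(e.g. through the Bochner/junk conventions at cold or dense pockets) forces a pivot to a
truncated-entropy restatement, not a close. AnnealedWeakStrong is a theorem-shaped PDE item: a
counterexample can only come from the state-space issues named in its why-line and forces a
restatement with a stronger moment hypothesis. Refutation of ZeroHorizonSpread in the intended
witness class (spread o(1) at fixed t after a subsonic slip surface, at N with Kn(log N)² ≪ 1)
retires the card's headline but leaves X₊ intact — the route would then be edited to drop X₋.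
DiluteSelfConsistency refuted (DenseExcursion proved in route ImplosionLoophole) breaks the assembly
exactly as it breaks every σ₀-from-cluster-expansion route; repair = restate
AnnealedWeakStrong/assembly on the packing-guarded conjunct HydroLimitInBand. RelEntropyVanishing or
L2HydroFields proved elsewhere moots X₊ (not X₋).

NOT DECOMPOSED YET. Deliberately not filed at open: (a) the card's onset law Z4 (linearised
hs-Navier–Stokes–Fourier around the viscously spreading tangential discontinuity,
CLT/Landau–Lifshitz seeds of covariance N⁻¹, transient growth reaching O(1) at t′_E = C·Kn(log
N)²(1+o(1)); no growth in 2-D for ΔU > 2√2 c) — filed as an INFORMAL ranked statement right after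
open, typable once a linearised compressible NS vocabulary exists; (b) the hard-DISK litmus (d = 2,
Kn = N^(−1/2): subsonic slip line ⇒ spread, supersonic ⇒ none, decided by the Lopatinskii condition
of CoulombelSecchi2004) — needs 2-D versions of hsDiameter/localGibbsLaw; (c) the positive
post-shock statement HL-S (Law(U_N(t)) ⇒ μ_t, a dissipative statistical solution of hs-Euler, for
all t) and the CONDITIONAL-MEAN closure ⇒ FLM moment hierarchy step (card Z2 proper), which need a
`DissipativeStatisticalSolution` definition (request deferred until MeanFluxClosure has a grounder);
(d) universality across regularisations (card Z5, docking target only); (e) constants of the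
relative-energy inequality for the hs-EOS, uniform integrability lemmas for local Gibbs velocity
moments, joint measurability of (s,z) ↦ Φ_s z on the good set (children of AnnealedWeakStrong /
MeanFluxClosure, layer 2).

CHEAPEST FALSIFIER. For X₋: a 2-D hard-disk event-driven MD run (kit) — N = 10⁶–10⁷ disks, 20
realisations of one smoothed four-quadrant datum producing a subsonic slip line, versus one
producing a supersonic slip line (ΔU > 2√2 c): the realisation variance of ⟨m_N(t), χ⟩ near the slip
line must jump from O(N⁻¹) to O(1) within t′ ≍ Kn(log N)² of the triple point in the first case and
stay O(N⁻¹) in the second; no jump in the subsonic case at N with Kn(log N)² ≪ 1 kills the mechanism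
(not run here: the hub is compute-free for planners in this mode and the job is a multi-hour MD
campaign). For X₊: a grounder's reading of FjordholmEtAl2020 Lemma 28 (done: pp. 10–11 of
arXiv:1906.02536, M = 1 uses only the first-moment equation and Def. 27(ii)) and of
BrezinaFeireisl2018 Thm 3.3 for whether the relative-energy remainder bound survives an EOS p =
ρθZ(ρσ³) with Z only limsup/deriv-defined beyond the virial radius — if it does not,
AnnealedWeakStrong must carry an explicit state-space truncation.

NUMBERS. Kn ≍ σ⁻²(N+1)^(−1/3) (mean free path / box at reduced density σ³); smooth-shear Ehrenfest
horizon t_E ≍ (2γ)⁻¹ log N (card knudsen-rate-law-and-ehrenfest-horizon); slip-surface horizon t′_E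
≍ Kn(log N)²/(64ΔU²) with layer Reynolds number ≍ ΔU log N/c at onset (card, §Mechanism (1)); 2-D
vortex-sheet stability threshold ΔU > 2√2·c (Miles1958; nonlinear: CoulombelSecchi2004,
CoulombelSecchi2008), none in 3-D (FejerMiles1963); mixing-layer growth δ_mix ≍ c_BR ΔU t′, c_BR ≈
0.16–0.18 (BrownRoshko1974); FLMW weak–strong: W₂(μ_t, δ_{v(t)}) ≤ e^{Ct} W₂(μ_0, δ_{v(0)})
(FjordholmEtAl2020 Lemma 28). Items at open: 9 typed (4 cruxes, 4 supports, 1 assembly) + 1 informal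
crux (OnsetLaw) filed after open; the conclusion of AnnealedWeakStrong is verbatim HydroLimitInBand
(stmt-AtomisticToContinuum-3093) and DiluteSelfConsistency is verbatim
stmt-AtomisticToContinuum-3091.

DEFINITION REQUESTS. Deferred (see Not decomposed yet (c)): `DissipativeStatisticalSolution`
(FjordholmEtAl2020 Def. 27, topic Literature/Analysis/FluidPDE) and a linearised compressible
Navier–Stokes–Fourier vocabulary for OnsetLaw. No cite-fact is used as a hypothesis in any typed
item (the import cone of the typed statements is the sub-problem Statement only).

Novelty: Searches (2026-08-15): `lit search --source crossref "statistical solutions hyperbolic systems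
conservation laws numerical approximation Fjordholm Lye Mishra Weber"` (8; FjordholmEtAl2020,
FjordholmLanthalerMishra2017, FKMT2015 found); `lit search --source crossref "statistical solutions
Euler equations vanishing viscosity limit particle system hydrodynamic limit"` (7; only PDE
vanishing-viscosity papers, Chae 1991 doi:10.1016/0022-247x(91)90013-p, Basarić 2020,
Feireisl–Klingenberg–Markfelder 2022 — no particle system); `lit search --source crossref
"spontaneous stochasticity Kelvin-Helmholtz thermal fluctuations molecular dynamics"` (8; 0
relevant); `lit search --source zbmath "statistical solutions weak-strong uniqueness Euler"` (5;
stochastic-NS weak–strong only); `lit galaxy search "spontaneous stochasticity" --star all` (16: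
Mailybaev–Raibekas arXiv:2111.03666 rigorous toy model, Eyink–Bandak–Goldenfeld arXiv:2107.13954,
Biferale et al. arXiv:1802.05021); `lit galaxy search "dissipative statistical solution" --star pdf`
(2: Giesselmann–Meyer–Rohde arXiv:1912.04323 a-posteriori relative entropy for statistical
solutions); `lit frontier AtomisticToContinuum --since 2021` (30, none on statistical solutions or
fluctuating hydrodynamics of hard spheres); `lit bridges AtomisticToContinuum --cross any`; `lit
read arxiv:1906.02536` pp. 10–12 (Def. 27, Lemma 28, Thm 30 verified); local searchd and
OpenAlex/arXiv/S2 were down or rate-limited this session (noted).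
Nearest prior ar  [refs: 10.1016/0022-247x(91, 10.1142/s0218202520500141:, 10.1103/physrevlett.132.104002, 10.1088/1361-6544/adf605:, 2111.03666, 2107.13954, 1802.05021, 1912.04323, 1906.02536, doi:10.1016/0022-247x, arxiv:1906.02536, doi:10.1142/s0218202520500141, doi:10.1103/physrevlett.132.104002, doi:10.1088/1361-6544/adf605, FjordholmEtAl2020, FjordholmLanthalerMishra2017, BandakEtAl2024, EyinkPeng2025, ThalabardBecM]

Barriers (technique_class: statistical-solutions annealed-closure instability-horizon): - technique_class: statistical-solutions annealed-closure instability-horizon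
- Literature.Barriers.AtomisticToContinuum.ShockFormationBarrier: respected, not evaded, by X₊
(AnnealedWeakStrong is a weak–strong argument and stops at the classical time T, exactly the
conjunct's scope); X₋ is the route's account of what lies beyond: not a deterministic limit at all
after the first slip surface, so the "global strengthening" the barrier blocks is claimed false in
law-degenerate form and re-targeted at limits in law.
- Literature.Barriers.AtomisticToContinuum.WildSolutionsBarrier: sidestepped by changing the limit
object — nothing here selects an admissible weak solution past T; ZeroHorizonSpread predicts the
physical ensemble spreads over them (EyinkPeng2025 reads non-uniqueness the same way); uniqueness of
the statistical limit (FLM conjecture) is docked, not claimed.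
- Literature.Barriers.AtomisticToContinuum.BoltzmannHypothesisBarrier: it does not evade it; the bet
is that the ergodic input is needed only in its weakest, ANNEALED form (MeanFluxClosure:
expectations of flux defects, no classification of invariant measures, no pathwise statement) and
that the second law comes for free from Liouville + statics (MeanSecondLaw), leaving one honest open
crux instead of two.
- Literature.Barriers.AtomisticToContinuum.MacroErgodicityBarrier: same answer as for the Boltzmann
hypothesis — MeanFluxClosure is the macro-ergodic input in mean form; not evaded, isolated and
typed.
- Literatu

History (route lifecycle, newest last):
- 2026-08-15T13:47:37Z · CLOSED retired — not-a-thesis: assembly does not conclude the sub-problem Statement (operator:999:1257524)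

sub-problem: HydrodynamicLimit · status: closed(retired) · opened planner-plancard-AtomisticToContinuum-Hydrody-08149edb-0 2026-08-15T11:48:21Z · rev 0 · ledger route-AtomisticToContinuum-ZeroHorizon
GENERATED by the gate from the ledger (D-0016/17). Provers cite these decls: `theorem foo : Summit.AtomisticToContinuum.HydrodynamicLimit.Theses.ZeroHorizon.<Decl> := …` in Summits/AtomisticToContinuum/HydrodynamicLimit/Theorems/<Name>.lean.
-/

namespace Summit.AtomisticToContinuum.HydrodynamicLimit.Theses.ZeroHorizon

open scoped BigOperators Topology Manifold Classical MeasureTheory ProbabilityTheory Matrix InnerProductSpace ComplexConjugate ContinuousMap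
open Filter Set Function TopologicalSpace MeasureTheory

attribute [summit_statement] _root_.HydrodynamicLimit

/-- item stmt-AtomisticToContinuum-6579 · crux · rank 2 · closed · moot by None · by planner
why it might fail: hs-Euler slip surfaces from generic smooth data might be born with macroscopic width (horizon ≍ log N), be supersonic/stabilised by compressibility or density ratio (Miles, Coulombel–Secchi), or saturate at mesoscopic amplitude so the spread at fixed χ is o(1).
sources: ThalabardBecMailybaev2020, BandakEtAl2024, EyinkPeng2025, Miles1958, FejerMiles1963, CoulombelSecchi2004
[crux] (card Z1, zero-horizon variance explosion, in centring form) there are continuous positive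
profiles (a₀, θ₀) and u₀, a time t > 0, a continuous χ and δ > 0 such that for every σ₀ > 0 some
reduced density 0 < σ < σ₀ has: for every family of hard-sphere flows and EVERY deterministic
centring c : ℕ → V3, frequently in N the local Gibbs law gives probability ≥ δ to {‖⟨empirical
momentum field at time t, χ⟩ − c_N‖ > δ}. Equivalently two independent realisations differ by O(1)
with non-vanishing probability; intended witness: smoothed four-quadrant / oblique-shock data on 𝕋³
(functions of two coordinates) whose hs-Euler evolution produces a SUBSONIC slip surface at T_s,
observed at any fixed t > T_s. [difficulty: open-problem] -/
@[route_item "route-AtomisticToContinuum-ZeroHorizon"]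
def ZeroHorizonSpread : Prop :=
  ∃ (a₀ θ₀ : Literature.MathematicalPhysics.KineticTheory.T3 → ℝ) (u₀ : Literature.MathematicalPhysics.KineticTheory.T3 → Literature.MathematicalPhysics.KineticTheory.V3), Continuous a₀ ∧ Continuous θ₀ ∧ Continuous u₀ ∧ (∀ x, 0 < a₀ x) ∧ (∀ x, 0 < θ₀ x) ∧ ∃ t : ℝ, 0 < t ∧ ∃ χ : Literature.MathematicalPhysics.KineticTheory.T3 → ℝ, Continuous χ ∧ ∃ δ : ℝ, 0 < δ ∧ ∀ σ₀ : ℝ, 0 < σ₀ → ∃ σ : ℝ, 0 < σ ∧ σ < σ₀ ∧ ∀ Φ : (N : ℕ) → Literature.Analysis.FluidPDE.HardSphereFlow (Literature.Analysis.FluidPDE.Torus.geometry (Fin 3)) (Literature.MathematicalPhysics.KineticTheory.hsDiameter σ N) (N + 1), ∀ c : ℕ → Literature.MathematicalPhysics.KineticTheory.V3, ∃ᶠ N in Filter.atTop, ENNReal.ofReal δ ≤ Literature.MathematicalPhysics.KineticTheory.localGibbsLaw σ a₀ u₀ θ₀ N (Φ N) {z | δ < ‖Literature.MathematicalPhysics.KineticTheory.empiricalMomentumField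 ((Φ N).flow t z) χ - c N‖}

/-- item stmt-AtomisticToContinuum-6580 · crux · rank 3 · closed · moot by None · by planner
why it might fail: Local equilibrium of contact statistics must hold IN MEAN along deterministic dynamics at fixed density: persistent ring/recollision correlations (O(1) per mean free time) could shift E[flux] off ρu⊗u + ρθZ𝟙 at leading order; post-shock the ℓ → 0 limit must absorb subscale Reynolds stresses.
sources: Spohn1991, OllaVaradhanYau1993, FjordholmLanthalerMishra2017, FjordholmEtAl2020, KipnisLandim1999
[crux] (card Z2 in annealed form: the universal closure crux, weakest version) for all continuous
positive profiles there is σ₀ > 0 such that for 0 < σ < σ₀, every flow family, all times 0 ≤ t₁ ≤ t₂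
and ε > 0, for every smooth scalar ψ (energy) and smooth vector field φ (momentum) there is a kernel
radius ℓ > 0 such that for every continuous probability kernel k supported in the ℓ-ball, eventually
in N, the PATHWISE defects ⟨E_N(t₂) − E_N(t₁), ψ⟩ − ∫_{t₁}^{t₂}∫ ((E^k + p)/ρ^k) m^k·∇ψ dx ds and
⟨m_N(t₂) − m_N(t₁), φ⟩ − ∫_{t₁}^{t₂}∫ [(m^k⊗m^k/ρ^k):∇φ + p div φ] dx ds — (ρ^k, m^k, E^k) the
k-mollified empirical fields of the time-s configuration, θ^k = ⅔(E^k/ρ^k − |m^k|²/2(ρ^k)²), p =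
hsPressure σ ρ^k θ^k — are integrable under the local Gibbs law and have |expectation| ≤ ε. Only the
MEAN over the initial law is asked (annealed), not smallness in probability of the defect
(quenched): this is what a statistical-solution limit needs and strictly less than mv/Young-measure
identification; the continuity equation is exact and filed separately (MassContinuity). [difficulty:
open-problem] -/
@[route_item "route-AtomisticToContinuum-ZeroHorizon"]
def MeanFluxClosure : Prop :=
  ∀ (a₀ θ₀ : Literature.MathematicalPhysics.KineticTheory.T3 → ℝ) (u₀ : Literature.MathematicalPhysics.KineticTheory.T3 → Literature.MathematicalPhysics.KineticTheory.V3), Continuous a₀ → Continuous θ₀ → Continuous u₀ → (∀ x, 0 < a₀ x) → (∀ x, 0 < θ₀ x) → ∃ σ₀ : ℝ, 0 < σ₀ ∧ ∀ σ : ℝ, 0 < σ → σ < σ₀ → ∀ Φ : (N : ℕ) → Literature.Analysis.FluidPDE.HardSphereFlow (Literature.Analysis.FluidPDE.Torus.geometry (Fin 3)) (Literature.MathematicalPhysics.KineticTheory.hsDiameter σ N) (N + 1), ∀ t₁ t₂ : ℝ, 0 ≤ t₁ → t₁ ≤ t₂ → ∀ ε : ℝ, 0 < ε → (∀ ψ :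 Literature.MathematicalPhysics.KineticTheory.T3 → ℝ, Literature.Analysis.FunctionSpaces.Torus.IsSmooth ψ → ∃ ℓ : ℝ, 0 < ℓ ∧ ∀ k : Literature.MathematicalPhysics.KineticTheory.T3 → ℝ, (Continuous k ∧ (∀ y, 0 ≤ k y) ∧ (∫ y, k y = 1) ∧ (∀ y, k y ≠ 0 → Literature.Analysis.FluidPDE.Torus.euclidDist y 0 < ℓ)) → ∀ᶠ N in Filter.atTop, let D : Literature.Analysis.FluidPDE.Config (N + 1) (Fin 3) Literature.MathematicalPhysics.KineticTheory.T3 → ℝ := fun z => (Literature.MathematicalPhysics.KineticTheory.empiricalEnergyField ((Φ N).flow t₂ z) ψ - Literature.MathematicalPhysics.KineticTheory.empiricalEnergyField ((Φ N).flow t₁ z) ψ) - ∫ s in t₁..t₂, ∫ x, (let R : ℝ := Literature.MathematicalPhysics.KineticTheory.empiricalDensityField ((Φ N).flow s z) (fun y => k (x - y)); let Mv : Literature.MathematicalPhysics.KineticTheory.V3 := Literature.MathematicalPhysics.KineticTheory.empiricalMomentumField ((Φ N).flow s z) (fun y => k (x - y)); let En : ℝ := Literature.MathematicalPhysics.KineticTheory.empiricalEnergyField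 ((Φ N).flow s z) (fun y => k (x - y)); let Θ : ℝ := 2 / 3 * (En / R - ‖Mv‖ ^ 2 / (2 * R ^ 2)); let Pr : ℝ := Literature.MathematicalPhysics.KineticTheory.hsPressure σ R Θ; ((En + Pr) / R) * (∑ i, Mv i * Literature.Analysis.FunctionSpaces.Torus.partialDeriv i ψ x)); MeasureTheory.Integrable D (Literature.MathematicalPhysics.KineticTheory.localGibbsLaw σ a₀ u₀ θ₀ N (Φ N)) ∧ |∫ z, D z ∂Literature.MathematicalPhysics.KineticTheory.localGibbsLaw σ a₀ u₀ θ₀ N (Φ N)| ≤ ε) ∧ (∀ φ : Literature.MathematicalPhysics.KineticTheory.T3 → Literature.MathematicalPhysics.KineticTheory.V3, Literature.Analysis.FunctionSpaces.Torus.IsSmooth φ → ∃ ℓ : ℝ, 0 < ℓ ∧ ∀ k : Literature.MathematicalPhysics.KineticTheory.T3 → ℝ, (Continuous k ∧ (∀ y, 0 ≤ k y) ∧ (∫ y, k y = 1) ∧ (∀ y, k y ≠ 0 → Literature.Analysis.FluidPDE.Torus.euclidDist y 0 < ℓ)) → ∀ᶠ N in Filter.atTop, let D : Literature.Analysis.FluidPDE.Config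 (N + 1) (Fin 3) Literature.MathematicalPhysics.KineticTheory.T3 → ℝ := fun z => ((∑ i, (Literature.MathematicalPhysics.KineticTheory.empiricalMomentumField ((Φ N).flow t₂ z) (fun y => φ y i)) i) - (∑ i, (Literature.MathematicalPhysics.KineticTheory.empiricalMomentumField ((Φ N).flow t₁ z) (fun y => φ y i)) i)) - ∫ s in t₁..t₂, ∫ x, (let R : ℝ := Literature.MathematicalPhysics.KineticTheory.empiricalDensityField ((Φ N).flow s z) (fun y => k (x - y)); let Mv : Literature.MathematicalPhysics.KineticTheory.V3 := Literature.MathematicalPhysics.KineticTheory.empiricalMomentumField ((Φ N).flow s z) (fun y => k (x - y)); let En : ℝ := Literature.MathematicalPhysics.KineticTheory.empiricalEnergyField ((Φ N).flow s z) (fun y => k (x - y)); let Θ : ℝ := 2 / 3 * (En / R - ‖Mv‖ ^ 2 / (2 * R ^ 2)); let Pr : ℝ := Literature.MathematicalPhysics.KineticTheory.hsPressure σ R Θ; (∑ i, ∑ j, (Mv i * Mv j / R) * Literature.Analysis.FunctionSpaces.Torus.partialDeriv j (fun y => φ y i) x) + Pr * Literature.Analysis.FunctionSpaces.Torus.divergence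 φ x); MeasureTheory.Integrable D (Literature.MathematicalPhysics.KineticTheory.localGibbsLaw σ a₀ u₀ θ₀ N (Φ N)) ∧ |∫ z, D z ∂Literature.MathematicalPhysics.KineticTheory.localGibbsLaw σ a₀ u₀ θ₀ N (Φ N)| ≤ ε)

/-- item stmt-AtomisticToContinuum-6581 · crux · rank 4 · closed · moot by None · by planner
why it might fail: Needs the LDP / equivalence of ensembles for the mollified (ρ,m,E)-profile under the canonical hard-sphere state on all states the coarse-grained field visits; Georgii1994 covers small activity, but dense or cold pockets enter through hsExcessFreeEnergy where no expansion converges.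
sources: Georgii1994, GeorgiiZessin1993, Ruelle1969, LebowitzPenrose1964, FjordholmEtAl2020, Spohn1991
[crux] (the free second law, annealed; cf. card invariant-gibbs-entropy-bookkeeping (ii)) for all
continuous positive profiles there is σ₀ > 0 such that for 0 < σ < σ₀, every flow family and every
triple (ρ₁, u₁, θ₁) that is the time-0 limit in probability of the empirical fields: for every t ≥ 0
and ε > 0 there is ℓ > 0 such that for every continuous probability kernel k supported in the
ℓ-ball, eventually in N, the coarse-grained mathematical entropy S(z) = ∫ η_σ(ρ^k, m^k, E^k)(x) dx
of the time-t configuration, η_σ(U) = −ρ(3/2 log θ(U) − log ρ − hsExcessFreeEnergy(ρσ³)), is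
integrable under the local Gibbs law and E[S] ≤ ∫ η_σ(ρ₁, ρ₁u₁, E(ρ₁,u₁,θ₁)) dx + ε. Proposed proof:
H(P_t | G) = H(P_0 | G) for the invariant canonical Gibbs law G (Liouville,
HardSphereFlow.measurePreserving), Donsker–Varadhan + Varadhan's lemma against the Georgii
large-deviation principle of the k-mollified profile under G at small activity, Jensen for
k-averages (η_σ convex), and exact conservation of ∫U^k dx; this is FjordholmEtAl2020 Def. 27(ii)
for the limit law. [difficulty: L] -/
@[route_item "route-AtomisticToContinuum-ZeroHorizon"]
def MeanSecondLaw : Prop :=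
  ∀ (a₀ θ₀ : Literature.MathematicalPhysics.KineticTheory.T3 → ℝ) (u₀ : Literature.MathematicalPhysics.KineticTheory.T3 → Literature.MathematicalPhysics.KineticTheory.V3), Continuous a₀ → Continuous θ₀ → Continuous u₀ → (∀ x, 0 < a₀ x) → (∀ x, 0 < θ₀ x) → ∃ σ₀ : ℝ, 0 < σ₀ ∧ ∀ σ : ℝ, 0 < σ → σ < σ₀ → ∀ Φ : (N : ℕ) → Literature.Analysis.FluidPDE.HardSphereFlow (Literature.Analysis.FluidPDE.Torus.geometry (Fin 3)) (Literature.MathematicalPhysics.KineticTheory.hsDiameter σ N) (N + 1), ∀ (ρ₁ θ₁ : Literature.MathematicalPhysics.KineticTheory.T3 → ℝ) (u₁ : Literature.MathematicalPhysics.KineticTheory.T3 → Literature.MathematicalPhysics.KineticTheory.V3), Literature.MathematicalPhysics.KineticTheory.TendstoHydroFieldsAt (fun N => Literature.MathematicalPhysics.KineticTheory.localGibbsLaw σ a₀ u₀ θ₀ N (Φ N)) Φ (fun _ => ρ₁) (fun _ => u₁) (fun _ => θ₁) 0 → ∀ t : ℝ, 0 ≤ t → ∀ ε : ℝ, 0 <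 ε → ∃ ℓ : ℝ, 0 < ℓ ∧ ∀ k : Literature.MathematicalPhysics.KineticTheory.T3 → ℝ, (Continuous k ∧ (∀ y, 0 ≤ k y) ∧ (∫ y, k y = 1) ∧ (∀ y, k y ≠ 0 → Literature.Analysis.FluidPDE.Torus.euclidDist y 0 < ℓ)) → ∀ᶠ N in Filter.atTop, let S : Literature.Analysis.FluidPDE.Config (N + 1) (Fin 3) Literature.MathematicalPhysics.KineticTheory.T3 → ℝ := fun z => ∫ x, (let R : ℝ := Literature.MathematicalPhysics.KineticTheory.empiricalDensityField ((Φ N).flow t z) (fun y => k (x - y)); let Mv : Literature.MathematicalPhysics.KineticTheory.V3 := Literature.MathematicalPhysics.KineticTheory.empiricalMomentumField ((Φ N).flow t z) (fun y => k (x - y)); let En : ℝ := Literature.MathematicalPhysics.KineticTheory.empiricalEnergyField ((Φ N).flow t z) (fun y => k (x - y)); let Θ : ℝ := 2 / 3 * (En / R - ‖Mv‖ ^ 2 / (2 * R ^ 2)); -(R * (3 / 2 * Real.log Θ - Real.log R - Literature.MathematicalPhysics.KineticTheory.hsExcessFreeEnergy (R * σ ^ 3)))); MeasureTheory.Integrable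 S (Literature.MathematicalPhysics.KineticTheory.localGibbsLaw σ a₀ u₀ θ₀ N (Φ N)) ∧ ∫ z, S z ∂Literature.MathematicalPhysics.KineticTheory.localGibbsLaw σ a₀ u₀ θ₀ N (Φ N) ≤ (∫ x, -((ρ₁ x) * (3 / 2 * Real.log (2 / 3 * ((Literature.MathematicalPhysics.KineticTheory.totalEnergyDensity (ρ₁ x) (u₁ x) (θ₁ x)) / (ρ₁ x) - ‖(ρ₁ x) • u₁ x‖ ^ 2 / (2 * (ρ₁ x) ^ 2))) - Real.log (ρ₁ x) - Literature.MathematicalPhysics.KineticTheory.hsExcessFreeEnergy ((ρ₁ x) * σ ^ 3)))) + ε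

/-- item stmt-AtomisticToContinuum-6582 · crux · rank 5 · closed · moot by None · by planner
why it might fail: Relative flux ≲ relative entropy and coercivity of η_σ(U|Ū) are needed on ALL states the mollified particle fields take (near-vacuum, cold spots, packing near close-packing where hsExcessFreeEnergy is limsup-defined), not only near the strong solution; FLMW assume bounded Hessians, Euler has none.
sources: FjordholmEtAl2020, Dafermos1979, BrezinaFeireisl2018, GwiazdaSwierczewskagwiazdaWiedemann2015, BrenierDeLellisSzekelyhidi2011, LanthalerMishraParespulido2021
[crux] (card Z3, statistical weak–strong uniqueness for the hs equation of state collapsed to first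
moments; PDE + measure theory) MeanFluxClosure → MeanSecondLaw → HydroLimitInBand, where the
conclusion is VERBATIM the packing-guarded conjunct of route ImplosionLoophole
(stmt-AtomisticToContinuum-3093): ∃ η₀ > 0 such that for all continuous positive profiles ∃ σ₀ ∀ σ <
σ₀, every classical hs-Euler solution on [0,T) with ρσ³ < η₀ throughout and every flow family whose
local Gibbs fields converge at t = 0 has fields converging in probability at every t < T. Intended
proof = the LOCAL theorem (per σ, per solution): FjordholmEtAl2020 Lemma 28 with M = 1 — evolve
E∫η_σ(U^k_N(t) | U^E(t)) dx by the mean conservation laws tested with η_σ′(U^E) (time-stepped; mass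
from MassContinuity), isentropy of the classical solution and the mean entropy bound; flux remainder
|F(U) − F(Ū) − DF(Ū)(U−Ū)| ≲ η_σ(U|Ū) by the relative-energy technique for the complete Euler system
(BrezinaFeireisl2018) with strict convexity of η_σ at packing < η₀ (HsEntropyConvex of route
DissipativeWeakStrong); E∫η_σ(·|·) → 0 gives ∫|U^k − U^E| → 0 in probability, then ℓ → 0 by
continuity of χ. [deps: MeanFluxClosure, Mean -/
@[route_item "route-AtomisticToContinuum-ZeroHorizon"]
def AnnealedWeakStrong : Prop :=
  MeanFluxClosure → MeanSecondLaw → ∃ η₀ : ℝ, 0 < η₀ ∧ ∀ (a₀ θ₀ : Literature.MathematicalPhysics.KineticTheory.T3 → ℝ) (u₀ : Literature.MathematicalPhysics.KineticTheory.T3 → Literature.MathematicalPhysics.KineticTheory.V3), Continuous a₀ → Continuous θ₀ → Continuous u₀ → (∀ x, 0 < a₀ x) → (∀ x, 0 < θ₀ x) → ∃ σ₀ : ℝ, 0 < σ₀ ∧ ∀ σ : ℝ, 0 < σ → σ < σ₀ → ∀ (T : ℝ) (ρ θ : ℝ → Literature.MathematicalPhysics.KineticTheory.T3 → ℝ) (u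 : ℝ → Literature.MathematicalPhysics.KineticTheory.T3 → Literature.MathematicalPhysics.KineticTheory.V3), Literature.MathematicalPhysics.KineticTheory.IsHardSphereEulerSolution σ T ρ u θ → (∀ t ∈ Set.Ico 0 T, ∀ x, ρ t x * σ ^ 3 < η₀) → ∀ Φ : (N : ℕ) → Literature.Analysis.FluidPDE.HardSphereFlow (Literature.Analysis.FluidPDE.Torus.geometry (Fin 3)) (Literature.MathematicalPhysics.KineticTheory.hsDiameter σ N) (N + 1), Literature.MathematicalPhysics.KineticTheory.TendstoHydroFieldsAt (fun N => Literature.MathematicalPhysics.KineticTheory.localGibbsLaw σ a₀ u₀ θ₀ N (Φ N)) Φ ρ u θ 0 → ∀ t ∈ Set.Ico 0 T, Literature.MathematicalPhysics.KineticTheory.TendstoHydroFieldsAt (fun N => Literature.MathematicalPhysics.KineticTheory.localGibbsLaw σ a₀ u₀ θ₀ N (Φ N)) Φ ρ u θ t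

-- item stmt-AtomisticToContinuum-7455 · crux · rank 6 · closed · moot by None · by planner — informal only, no Lean statement yet:
--   [crux] ONSET LAW (card Z4; linear and particle-free — the mechanism behind ZeroHorizonSpread,
--   informal until a linearised compressible Navier–Stokes–Fourier vocabulary exists): for the
--   hard-sphere Navier–Stokes–Fourier system at reduced density σ (Enskog-order viscosity and
--   conductivity, Knudsen number Kn ≍ σ⁻²(N+1)^(−1/3)) linearised around the viscously spreading
--   tangential discontinuity of velocity jump ΔU born at t′ = 0 (error-function shear profile of width
--   (Kn t′)^(1/2), density/temperature ratio r across it), driven at t′ = 0 by the Gaussian fluctuation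
--   field of the local Gibbs law (CLT

/-- item stmt-AtomisticToContinuum-3091 · support · rank 9 · open · by planner
why it might fail: Refuters flag the ∀-profile ∀-T form as suspect-false (smooth implosion, MRRS 2022 / Buckmaster–Cao-Labora–Gómez-Serrano); DenseExcursion of route ImplosionLoophole would refute it outright.
sources: Sideris1985, LukSpeck2024, CaolaboraEtAl2025, BuckmasterCaolaboraGomezserrano2025, Spohn1991
[crux] (card crux 1B ∪ 3; the hidden PDE crux of every route) for every η > 0 and all continuous
positive profiles there is σ₀ > 0 such that for 0 < σ < σ₀, every classical hard-sphere-Euler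
solution on [0,T) whose t = 0 fields are the LLN limit of the local Gibbs laws satisfies ρ_t(x)σ³ <
η for all t < T and x — i.e. limsup_{σ→0} σ³ sup_{t<T*_σ} ‖ρ_σ(t)‖_∞ = 0 profile by profile. For
profiles whose ideal-gas development is global or breaks by a non-degenerate shock (Luk–Speck /
Buckmaster–Shkoller–Vicol open sets) this is stability of shock formation under an O(σ³)
equation-of-state and data perturbation; in general it is a σ-uniform density bound at the FIRST
singularity of 3-D compressible Euler for all smooth data. [deps: EosContinuity,
LocalGibbsDensityLimit] [difficulty: open-problem] -/
@[route_item "route-AtomisticToContinuum-ZeroHorizon"]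
def DiluteSelfConsistency : Prop :=
  ∀ η : ℝ, 0 < η → ∀ (a₀ θ₀ : Literature.MathematicalPhysics.KineticTheory.T3 → ℝ) (u₀ : Literature.MathematicalPhysics.KineticTheory.T3 → Literature.MathematicalPhysics.KineticTheory.V3), Continuous a₀ → Continuous θ₀ → Continuous u₀ → (∀ x, 0 < a₀ x) → (∀ x, 0 < θ₀ x) → ∃ σ₀ : ℝ, 0 < σ₀ ∧ ∀ σ : ℝ, 0 < σ → σ < σ₀ → ∀ (T : ℝ) (ρ θ : ℝ → Literature.MathematicalPhysics.KineticTheory.T3 → ℝ) (u : ℝ → Literature.MathematicalPhysics.KineticTheory.T3 → Literature.MathematicalPhysics.KineticTheory.V3), Literature.MathematicalPhysics.KineticTheory.IsHardSphereEulerSolution σ T ρ u θ → ∀ Φ : (N : ℕ) → Literature.Analysis.FluidPDE.HardSphereFlow (Literature.Analysis.FluidPDE.Torus.geometry (Fin 3)) (Literature.MathematicalPhysics.KineticTheory.hsDiameter σ N) (N + 1), Literature.MathematicalPhysics.KineticTheory.TendstoHydroFieldsAt (fun N => Literature.MathematicalPhysics.KineticTheory.localGibbsLaw σ a₀ u₀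 θ₀ N (Φ N)) Φ ρ u θ 0 → ∀ t ∈ Set.Ico 0 T, ∀ x, ρ t x * σ ^ 3 < η

/-- item stmt-AtomisticToContinuum-6583 · support · rank 9 · closed · moot by None · by planner
sources: GST2013, Alexander1975, Spohn1991
[support] (exact continuity equation in the same annealed format; provable from the HardSphereFlow
trajectory axioms alone) for every σ > 0, continuous positive profiles, flow family, N, t₁ ≤ t₂ and
smooth ψ, the pathwise defect ⟨ρ_N(t₂),ψ⟩ − ⟨ρ_N(t₁),ψ⟩ − ∫_{t₁}^{t₂} Σᵢ ⟨m_N(s), ∂ᵢψ⟩ᵢ ds is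
integrable under the local Gibbs law with integral 0: it vanishes identically on the good set (free
flight + continuity of positions, FTC for piecewise-C¹ s ↦ ψ(x_k(s))) and the law is absolutely
continuous w.r.t. Liouville (particleLaw = withDensity). Feeds the mass equation to the prover of
AnnealedWeakStrong. [difficulty: M] -/
@[route_item "route-AtomisticToContinuum-ZeroHorizon"]
def MassContinuity : Prop :=
  ∀ σ : ℝ, 0 < σ → ∀ (a₀ θ₀ : Literature.MathematicalPhysics.KineticTheory.T3 → ℝ) (u₀ : Literature.MathematicalPhysics.KineticTheory.T3 → Literature.MathematicalPhysics.KineticTheory.V3), Continuous a₀ → Continuous θ₀ → Continuous u₀ → (∀ x, 0 < a₀ x) → (∀ x, 0 < θ₀ x) → ∀ Φ : (N : ℕ) → Literature.Analysis.FluidPDE.HardSphereFlow (Literature.Analysis.FluidPDE.Torus.geometry (Fin 3)) (Literature.MathematicalPhysics.KineticTheory.hsDiameter σ N) (N + 1), ∀ (N : ℕ) (t₁ t₂ : ℝ), t₁ ≤ t₂ → ∀ ψ : Literature.MathematicalPhysics.KineticTheory.T3 → ℝ, Literature.Analysis.FunctionSpaces.Torus.IsSmooth ψ → let D : Literature.Analysis.FluidPDE.Config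 (N + 1) (Fin 3) Literature.MathematicalPhysics.KineticTheory.T3 → ℝ := fun z => (Literature.MathematicalPhysics.KineticTheory.empiricalDensityField ((Φ N).flow t₂ z) ψ - Literature.MathematicalPhysics.KineticTheory.empiricalDensityField ((Φ N).flow t₁ z) ψ) - ∫ s in t₁..t₂, (∑ i, (Literature.MathematicalPhysics.KineticTheory.empiricalMomentumField ((Φ N).flow s z) (fun y => Literature.Analysis.FunctionSpaces.Torus.partialDeriv i ψ y)) i); MeasureTheory.Integrable D (Literature.MathematicalPhysics.KineticTheory.localGibbsLaw σ a₀ u₀ θ₀ N (Φ N)) ∧ ∫ z, D z ∂Literature.MathematicalPhysics.KineticTheory.localGibbsLaw σ a₀ u₀ θ₀ N (Φ N) = 0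

/-- item stmt-AtomisticToContinuum-6584 · support · rank 9 · closed · moot by None · by planner
sources: Spohn1991
[support] (glue, provable now; proof in the planner's Sketch.lean) for any laws P_N, flows, time t,
continuous χ and δ > 0: if for every centring c : ℕ → V3 frequently P_N{‖⟨m_N(t),χ⟩ − c_N‖ > δ} ≥ δ,
then NO fields (ρ,u,θ) whatsoever satisfy TendstoHydroFieldsAt P Φ ρ u θ t. Makes ZeroHorizonSpread
a typed refutation of every deterministic description at time t (classical, weak, mv-barycentre …).
[difficulty: provable-now] -/
@[route_item "route-AtomisticToContinuum-ZeroHorizon"]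
def SpreadExcludesLimit : Prop :=
  ∀ (ε : ℕ → ℝ) (P : (N : ℕ) → MeasureTheory.Measure (Literature.Analysis.FluidPDE.Config (N + 1) (Fin 3) Literature.MathematicalPhysics.KineticTheory.T3)) (Φ : (N : ℕ) → Literature.Analysis.FluidPDE.HardSphereFlow (Literature.Analysis.FluidPDE.Torus.geometry (Fin 3)) (ε N) (N + 1)) (t : ℝ) (χ : Literature.MathematicalPhysics.KineticTheory.T3 → ℝ) (δ : ℝ), Continuous χ → 0 < δ → (∀ c : ℕ → Literature.MathematicalPhysics.KineticTheory.V3, ∃ᶠ N in Filter.atTop, ENNReal.ofReal δ ≤ P N {z | δ < ‖Literature.MathematicalPhysics.KineticTheory.empiricalMomentumField ((Φ N).flow t z) χ - c N‖}) → ∀ (ρ θ : ℝ → Literature.MathematicalPhysics.KineticTheory.T3 → ℝ) (u : ℝ → Literature.MathematicalPhysics.KineticTheory.T3 → Literature.MathematicalPhysics.KineticTheory.V3), ¬ Literature.MathematicalPhysics.KineticTheory.TendstoHydroFieldsAt P Φ ρ u θ t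

/-- item stmt-AtomisticToContinuum-6585 · support · rank 9 · closed · moot by None · by planner
sources: Spohn1991, Sideris1985
[support] (glue, provable now; proof in Sketch.lean) if HydrodynamicLimitFor σ holds and the spread
of ZeroHorizonSpread occurs at (σ, profiles, t ≥ 0, χ, δ) for a flow family Φ, then every classical
hs-Euler solution on [0,T) whose time-0 fields are the local-Gibbs LLN limit along Φ has T ≤ t:
under the conjunct, randomisation by time t is a particle-level certificate of classical breakdown
before t (contrapositive: global classical solutions ⇒ no spread ever). [difficulty: provable-now] -/
@[route_item "route-AtomisticToContinuum-ZeroHorizon"]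
def SpreadBoundsClassicalTime : Prop :=
  ∀ σ : ℝ, Literature.MathematicalPhysics.KineticTheory.HydrodynamicLimitFor σ → ∀ (a₀ θ₀ : Literature.MathematicalPhysics.KineticTheory.T3 → ℝ) (u₀ : Literature.MathematicalPhysics.KineticTheory.T3 → Literature.MathematicalPhysics.KineticTheory.V3), Continuous a₀ → Continuous θ₀ → Continuous u₀ → (∀ x, 0 < a₀ x) → (∀ x, 0 < θ₀ x) → ∀ (t : ℝ) (χ : Literature.MathematicalPhysics.KineticTheory.T3 → ℝ) (δ : ℝ), 0 ≤ t → Continuous χ → 0 < δ → ∀ Φ : (N : ℕ) → Literature.Analysis.FluidPDE.HardSphereFlow (Literature.Analysis.FluidPDE.Torus.geometry (Fin 3)) (Literature.MathematicalPhysics.KineticTheory.hsDiameter σ N) (N + 1), (∀ c : ℕ → Literature.MathematicalPhysics.KineticTheory.V3, ∃ᶠ N in Filter.atTop, ENNReal.ofReal δ ≤ Literature.MathematicalPhysics.KineticTheory.localGibbsLaw σ a₀ u₀ θ₀ N (Φ N) {z | δ < ‖Literature.MathematicalPhysics.KineticTheory.empiricalMomentumField ((Φ N).flow t z) χ - c N‖})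 → ∀ (T : ℝ) (ρ θ : ℝ → Literature.MathematicalPhysics.KineticTheory.T3 → ℝ) (u : ℝ → Literature.MathematicalPhysics.KineticTheory.T3 → Literature.MathematicalPhysics.KineticTheory.V3), Literature.MathematicalPhysics.KineticTheory.IsHardSphereEulerSolution σ T ρ u θ → Literature.MathematicalPhysics.KineticTheory.TendstoHydroFieldsAt (fun N => Literature.MathematicalPhysics.KineticTheory.localGibbsLaw σ a₀ u₀ θ₀ N (Φ N)) Φ ρ u θ 0 → T ≤ t

/-- item stmt-AtomisticToContinuum-6586 · assembly · rank 1 · closed · moot by None · by planner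
sources: FjordholmEtAl2020, Spohn1991, OllaVaradhanYau1993
[assembly] MeanFluxClosure → MeanSecondLaw → AnnealedWeakStrong → DiluteSelfConsistency →
HydrodynamicLimit. -/
@[route_item "route-AtomisticToContinuum-ZeroHorizon"]
def Assembly : Prop :=
  MeanFluxClosure → MeanSecondLaw → AnnealedWeakStrong → DiluteSelfConsistency → Literature.MathematicalPhysics.KineticTheory.HydrodynamicLimit

end Summit.AtomisticToContinuum.HydrodynamicLimit.Theses.ZeroHorizon
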